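import Summits.CriticalPhenomena.PercolationContinuityZ3.Theorems.PercNearOneGluingNoHeavyLowerTailSahiThreeChainOrderThree
import Literature.Combinatorics.Sahi2008.PushForward

/-!
# Sahi's `C₃` in dimension three, VI: TRICHAIN FAMILIES — three increasing functions of three independent chain statistics
# (pull-back of the three-chain theorem along a block map; the cube reading)

Support file of the one-cut programme (crux `NoHeavyLowerTail`, stmt-CriticalPhenomena-4575; cell `prim-masterthm`, seat P3, gen 17;
`run/shared/lean/prim/prim-masterthm/prim-masterthm-p3/HIERARCHY.md` §25; memo `run/shared/lean/prim/prim-masterthm/FROM-prim-masterthm-p3-g17-THREE-CHAINS-C3.md`).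

SETTING.  `X₁, X₂, X₃` finite types with probability weights `w₁, w₂, w₃` (e.g. three pairwise disjoint blocks of coins with their product weights), `ℓ₁ : X₁ → α`,
`ℓ₂ : X₂ → β`, `ℓ₃ : X₃ → γ` ARBITRARY maps into finite linear orders ("chain statistics" of the blocks: number of leading ones, level in a nested chain of up-sets, a
threshold count, …), `f₀, f₁, f₂ : α × β × γ → ℝ` nonnegative and monotone for the product order.  Then (`sahiE_three_comp_blockMap_nonneg`)
  `E₃^{w₁⊗w₂⊗w₃}(f₀ ∘ (ℓ₁×ℓ₂×ℓ₃), f₁ ∘ (ℓ₁×ℓ₂×ℓ₃), f₂ ∘ (ℓ₁×ℓ₂×ℓ₃)) ≥ 0`.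
PROOF.  `E₃` only sees push-forwards (`sahiE_pushWeight`); the push-forward of `w₁⊗w₂⊗w₃` along the block map is the triple product of the push-forwards
(`pushWeight_blockMap`); and every triple product weight on a product of three finite chains is Sahi-positive of order 3 — gen 17's computer-assisted kernel theorem
`SahiThreeChain.sahiE_three_nonneg_prodWeight3` (`…SahiThreeChainOrderThree`).
READING for the crux (Kahn's Conjecture 5 = `C₃` on cubes): **every TRICHAIN triple on a cube with a product measure — three increasing events/functions each a
monotone function of the levels of three nested chains of up-sets living on three pairwise disjoint blocks — satisfies `E₃ ≥ 0`** (`sahiE_three_coin_triChain_nonneg`);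
all three members may depend on all coordinates, so the class is transversal to class T / cores / cylinders / read-once families (P2 gen 15's bichain class is the
two-block case).  HONEST FRAMING: `C₃` on general cubes remains OPEN; the base theorem rests on `native_decide` (`…SlotCertificate`). [this work]
-/

noncomputable section

namespace Summit.CriticalPhenomena.PercolationContinuityZ3.Theorems

namespace SahiThreeChain

open Finset Literature.Combinatorics.Sahi2008

variable {X₁ X₂ X₃ α β γ : Type*} [Fintype X₁] [Fintype X₂] [Fintype X₃]

/-- The block map `(x₁,x₂,x₃) ↦ (ℓ₁ x₁, ℓ₂ x₂, ℓ₃ x₃)`. [this work] -/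
def blockMap (ℓ₁ : X₁ → α) (ℓ₂ : X₂ → β) (ℓ₃ : X₃ → γ) : X₁ × X₂ × X₃ → α × β × γ := fun x => (ℓ₁ x.1, ℓ₂ x.2.1, ℓ₃ x.2.2)

omit [Fintype X₁] [Fintype X₂] [Fintype X₃] in
/-- The block map, pointwise. [this work] -/
theorem blockMap_apply (ℓ₁ : X₁ → α) (ℓ₂ : X₂ → β) (ℓ₃ : X₃ → γ) (x : X₁ × X₂ × X₃) :
    blockMap ℓ₁ ℓ₂ ℓ₃ x = (ℓ₁ x.1, ℓ₂ x.2.1, ℓ₃ x.2.2) := rfl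

/-- **The push-forward of a triple product weight along a block map is the triple product of the push-forwards.** [folklore] -/
theorem pushWeight_blockMap (w₁ : X₁ → ℝ) (w₂ : X₂ → ℝ) (w₃ : X₃ → ℝ) (ℓ₁ : X₁ → α) (ℓ₂ : X₂ → β) (ℓ₃ : X₃ → γ)
    (c : α × β × γ) :
    pushWeight (prodWeight3 w₁ w₂ w₃) (blockMap ℓ₁ ℓ₂ ℓ₃) c =
      prodWeight3 (pushWeight w₁ ℓ₁) (pushWeight w₂ ℓ₂) (pushWeight w₃ ℓ₃) c := by
  obtain ⟨c₁, c₂, c₃⟩ := c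
  simp only [pushWeight, prodWeight3, blockMap]
  rw [Fintype.sum_prod_type, Finset.sum_mul_sum, Finset.sum_mul]
  refine Finset.sum_congr rfl fun x _ => ?_
  rw [Fintype.sum_prod_type, Finset.sum_mul]
  refine Finset.sum_congr rfl fun y _ => ?_
  rw [Finset.mul_sum]
  refine Finset.sum_congr rfl fun u _ => ?_
  by_cases h1 : ℓ₁ x = c₁ <;> by_cases h2 : ℓ₂ y = c₂ <;> by_cases h3 : ℓ₃ u = c₃ <;> simp [h1, h2, h3, Prod.mk.injEq]

/-- **`E₃ ≥ 0` for trichain families**: `w₁, w₂, w₃` probability weights on finite types, `ℓ₁, ℓ₂, ℓ₃` any maps into finite linear orders, `f₀,f₁,f₂ ≥ 0`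
monotone on `α × β × γ`; then `E₃^{w₁⊗w₂⊗w₃}(f ∘ blockMap) ≥ 0`. [this work] -/
theorem sahiE_three_comp_blockMap_nonneg [Fintype α] [Fintype β] [Fintype γ] [LinearOrder α] [LinearOrder β] [LinearOrder γ]
    (w₁ : X₁ → ℝ) (w₂ : X₂ → ℝ) (w₃ : X₃ → ℝ) (h₁0 : ∀ x, 0 ≤ w₁ x) (h₁1 : ∑ x, w₁ x = 1) (h₂0 : ∀ y, 0 ≤ w₂ y)
    (h₂1 : ∑ y, w₂ y = 1) (h₃0 : ∀ u, 0 ≤ w₃ u) (h₃1 : ∑ u, w₃ u = 1) (ℓ₁ : X₁ → α) (ℓ₂ : X₂ → β) (ℓ₃ : X₃ → γ)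
    (f : Fin 3 → α × β × γ → ℝ) (hf : ∀ i c, 0 ≤ f i c) (hmono : ∀ i, Monotone (f i)) :
    0 ≤ sahiE (prodWeight3 w₁ w₂ w₃) 3 (fun i => f i ∘ blockMap ℓ₁ ℓ₂ ℓ₃) := by
  rw [← sahiE_pushWeight]
  have hpush : pushWeight (prodWeight3 w₁ w₂ w₃) (blockMap ℓ₁ ℓ₂ ℓ₃) =
      prodWeight3 (pushWeight w₁ ℓ₁) (pushWeight w₂ ℓ₂) (pushWeight w₃ ℓ₃) :=
    funext fun c => pushWeight_blockMap w₁ w₂ w₃ ℓ₁ ℓ₂ ℓ₃ c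
  rw [hpush]
  refine sahiE_three_nonneg_prodWeight3 (pushWeight w₁ ℓ₁) (pushWeight w₂ ℓ₂) (pushWeight w₃ ℓ₃)
    (fun a => pushWeight_nonneg h₁0 ℓ₁ a) (fun b => pushWeight_nonneg h₂0 ℓ₂ b) (fun c => pushWeight_nonneg h₃0 ℓ₃ c) ?_ ?_ ?_ f hf hmono
  · rw [sum_pushWeight, h₁1]
  · rw [sum_pushWeight, h₂1]
  · rw [sum_pushWeight, h₃1]

/-- **Coin form (cubes).**  Three pairwise disjoint blocks of independent coins `ι₁, ι₂, ι₃` with biases in `[0,1]`, chain statistics `ℓ₁, ℓ₂, ℓ₃` of the blocks,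
`f₀,f₁,f₂ ≥ 0` monotone on the product of the three chains: `E₃ ≥ 0` under the product coin weight for the pulled-back family — `C₃` for every trichain triple under
every product measure on the cube `2^{ι₁ ⊔ ι₂ ⊔ ι₃}`. [this work] -/
theorem sahiE_three_coin_triChain_nonneg {ι₁ ι₂ ι₃ : Type*} [Fintype ι₁] [Fintype ι₂] [Fintype ι₃] [DecidableEq ι₁] [DecidableEq ι₂]
    [DecidableEq ι₃] [Fintype α] [Fintype β] [Fintype γ]
    [LinearOrder α] [LinearOrder β] [LinearOrder γ] (q₁ : ι₁ → ℝ) (q₂ : ι₂ → ℝ) (q₃ : ι₃ → ℝ)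
    (hq₁ : ∀ i, 0 ≤ q₁ i ∧ q₁ i ≤ 1) (hq₂ : ∀ i, 0 ≤ q₂ i ∧ q₂ i ≤ 1) (hq₃ : ∀ i, 0 ≤ q₃ i ∧ q₃ i ≤ 1)
    (ℓ₁ : (ι₁ → Bool) → α) (ℓ₂ : (ι₂ → Bool) → β) (ℓ₃ : (ι₃ → Bool) → γ) (f : Fin 3 → α × β × γ → ℝ) (hf : ∀ i c, 0 ≤ f i c)
    (hmono : ∀ i, Monotone (f i)) :
    0 ≤ sahiE (prodWeight3 (coinWeight q₁) (coinWeight q₂) (coinWeight q₃)) 3 (fun i => f i ∘ blockMap ℓ₁ ℓ₂ ℓ₃) :=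
  sahiE_three_comp_blockMap_nonneg (coinWeight q₁) (coinWeight q₂) (coinWeight q₃) (fun y => coinWeight_nonneg hq₁ y) (sum_coinWeight q₁)
    (fun y => coinWeight_nonneg hq₂ y) (sum_coinWeight q₂) (fun y => coinWeight_nonneg hq₃ y) (sum_coinWeight q₃) ℓ₁ ℓ₂ ℓ₃ f hf hmono

omit [Fintype X₁] [Fintype X₂] [Fintype X₃] in
/-- The pulled-back family is monotone when the chain statistics are (so the coin form is a statement about INCREASING functions of the coins). [folklore] -/
theorem monotone_comp_blockMap [Preorder X₁] [Preorder X₂] [Preorder X₃] [Preorder α] [Preorder β] [Preorder γ]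
    {ℓ₁ : X₁ → α} {ℓ₂ : X₂ → β} {ℓ₃ : X₃ → γ} (hℓ₁ : Monotone ℓ₁) (hℓ₂ : Monotone ℓ₂) (hℓ₃ : Monotone ℓ₃)
    {g : α × β × γ → ℝ} (hg : Monotone g) : Monotone (g ∘ blockMap ℓ₁ ℓ₂ ℓ₃) := by
  intro x x' h
  apply hg
  simp only [blockMap_apply, Prod.mk_le_mk]
  exact ⟨hℓ₁ h.1, hℓ₂ h.2.1, hℓ₃ h.2.2⟩

end SahiThreeChain

end Summit.CriticalPhenomena.PercolationContinuityZ3.Theorems
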